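import Summits.QuantumFields.YangMills.Theorems.BalabanUVNodesN16HolderMSRegime
import Summits.QuantumFields.YangMills.Theorems.BalabanUVNodesN16HolderMSOfLeaf
import Summits.QuantumFields.YangMills.Theorems.BalabanUVNodesN16HolderMSTorusOfZd
import Summits.QuantumFields.YangMills.Theorems.BalabanUVNodesN16HolderLeafSlot

/-!
# Route «BalabanUVNodes», cluster K4 «SpineRates» — node N16 = NE3: THE RECORD-LEVEL MS-KIT (repair R-β″), LEAF FORM — the interface slot `LeafSlotHolderMS c β`
# (dag-n16-c's `LeafSlotHolder c β` on N05's family `zdGF3 (M_N ℂ) c.L β len` with the LENGTH LETTER `len (j•e_μ) = j` and the multi-scale Hölder threshold),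
# `LeafSlotHolderMS → LeafSlotHolder`, `LeafSlotHolderMS → PrintSlotHolderMS`, the one-application closers in N05's own currency at exponent `β ∈ [0, 1]`, and N05's leaf of
# record SHAPE `B8LeafRS` ⟹ `LeafSlotHolderMS`

Cell `pub-ymgap`, seat `pub-ymgap-dag-n16-e` (R134 acceleration seat (a), strategy s2 = BY-NAME KNIT at the record; HUMAN RULING D-0062; chair R424 venue), generation 6,
module 25 = (E2-MS) of the located item «the Hölder-exponent pin of N16's N05-socket» (`HOME/pub-ymgap-dag-n16-c/LOCATED-N16-HOLDER-PIN.md`), typed by this seat under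
dag-n16-c g4's ONE-DECLARER division (pub-ymgap INBOX DAGN16C-G4-ACK-N16E l.16473; this seat's INTENT-25 l.16577).  The TOKEN TWIN of dag-n16-c's (E2) `…N16HolderLeafSlot`
(p483883) over module 24 `…N16HolderMSRegime` (`PrintSlotHolderMS`, `InEndRegimeHMS`, the MS closers), dag-n16-c's column 34 `…N16HolderMSOfLeaf` (`thm4TorusAt_printMS_of_leaf`:
the leaf clauses ⟹ (T4^ℤᵈ_print-MS)) and column 32 `…N16HolderMSTorusOfZd` (`thm4TorusAt_printMS_of_zd`: the periodicity principle, MS) — MIRRORED, nothing edited.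
DEFINITION lane (ONE `def` + bookkeeping; 0 sorry).  `--supports stmt-QuantumFields-19912` (K3‴ `SpineGivenEndpointR13`).  `bears_on: R4∕N16 · edge N05 → N16`.

WHY.  Under R-β″ the N05 in-edge is consumed in N05's OWN typed currency (`B8.Thm4Body` ∕ `B8.Prop3Body` on the all-torus sub-family of `zdGF3 (M_N ℂ) c.L β len` at N05's
residual exponent `β`), exactly as under R-β — the (1.36)₃ member of N05's Prop-3 body is a supremum over ALL admissible pairs, so the multi-scale reading costs N05 NOTHING; it costs
the SLOT one extra socket letter, the length normalisation `len (j•e_μ) = j` along lattice lines (dag-n16-c's column 34), and the Hölder threshold pays the j × 1 ladder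
(`10·` for `8·`).  THIS FILE names that slot and closes it to `N16HolderMSAt` by one application, so a `Record13`-keyed home under R-β″ reads «`InEndRegimeHMS` ∧ `LeafSlotHolderMS · β`»
once per bundle (module 26, the MS N16 LINE).

WHAT THIS FILE DECLARES: §1 `LeafSlotHolderMS c β` · `leafSlotHolder_of_leafSlotHolderMS` (the MS leaf slot IMPLIES dag-n16-c's leaf β-slot — nothing of the β-kit is orphaned);
§2 `printSlotHolderMS_of_leafSlotHolderMS`; §3 closers `n16HolderMSAt_of_inEndRegimeHMS_leafSlotHolderMS` (`0 ≤ β ≤ 1`) · `n16HolderAt_of_inEndRegimeHMS_leafSlotHolder` ·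
`n16At_of_inEndRegimeHMS_leafSlot` · `s_N16HolderMS_of_inEndRegimeHMS_leafSlotHolderMS` · `s_N16Holder_of_inEndRegimeHMS_leafSlotHolder` · `s_N16_of_inEndRegimeHMS_leafSlot` (`RRec`-generic);
§4 `leafSlotHolderMS_of_b8LeafRS` (N05's leaf of record SHAPE ⟹ the MS leaf slot; the ROOT-level top `n16_holderMS_of_b8LeafRS` is dag-n16-c's column 36, not used here).
HONEST FRAMING: one definition and bookkeeping; `LeafSlotHolderMS` is a hypothesis SHAPE ([Balaban1985RegularSpaces] Thm 4 ∕ Prop 3 as typed by n05-a on the all-torus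
sub-family, Hölder member at its PRINTED exponent, and [Balaban1985Variational] Thm 1 (8)+(10) TYPE) asserted for no bundle; N05's leaf and N07's `LeafH3sup` stay hypotheses;
nothing of Bałaban's proved; **N16 ∕ NE3 NOT discharged**; R-β″ UNRULED (nothing of record edited); count-neutral (5∕27, A 5∕28 UNMOVED); one finite four-torus at fixed ε — NOT
ℝ⁴, NOT infinite volume, NOT OS, NOT a mass gap, NOT Clay.
-/

set_option autoImplicit false

open scoped BigOperators Matrix Matrix.Norms.L2Operator
open NormedSpace

namespace Summit.QuantumFields.YangMills.BalabanUVNodes.N16HolderMSLeafSlot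

open Literature.MathematicalPhysics.QuantumFieldTheory.Balaban1983to89
open Literature.MathematicalPhysics.QuantumFieldTheory.Balaban1983to89.T4Continuum (T4Family ULoop)
open B7Prop1Explicit B7Prop2Explicit
open B7Prop3Flat (c3)
open B7Eq92Concrete (mgauge)
open B8Ineq132 (covDerivFwd)
open B8Eq184Proof (cfgExp)
open B8Eq119TwistedAxial (Restr129)
open B8Eq133Hypotheses (Reg335Zd)
open B8Eq138LandauZd (IsLandau138 covLap)
open B8Thm4TorusAt (torusLam Thm4TorusAt)
open B8LeafModelZd (ZdIdx)
open B8LeafModelZd3 (zdGF3)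
open B8LeafKnitRS (B8LeafRS)
open Summit.QuantumFields.BalabanUV.T4Continuum
open T4AveragingDeficitWall (Ad)
open MinimalActionRate (sfClass)
open BlockAverageCurrent (curConst)
open NE3RightInverseSupLetters (frameC)
open NE3.LeafIndexSockets (LeafH3sup)
open YMDAG.UVSplit (Datum NE3Carriers RateCarriers RateRecordPred N16At S_N16)
open Summit.QuantumFields.YangMills.BalabanUVNodes.N16HolderDefs (N16HolderAt S_N16Holder)
open Summit.QuantumFields.YangMills.BalabanUVNodes.N16HolderMSDefs (N16HolderMSAt S_N16HolderMS)
open Summit.QuantumFields.YangMills.BalabanUVNodes.N16HolderLeafSlot (LeafSlotHolder n16HolderAt_of_inEndRegimeH_leafSlotHolder n16At_of_inEndRegimeH_leafSlot)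
open Summit.QuantumFields.YangMills.BalabanUVNodes.N16HolderMSRegime (PrintSlotHolderMS InEndRegimeHMS n16HolderMSAt_of_inEndRegimeHMS_printSlotHolderMS
  inEndRegimeH_of_inEndRegimeHMS)
open Summit.QuantumFields.YangMills.BalabanUVNodes.N16LeafSlot (LeafSlot)
open Summit.QuantumFields.YangMills.BalabanUVNodes.N16.OfLeaf (exists_window_print)
open Summit.QuantumFields.YangMills.BalabanUVNodes.N16HolderMSOfLeaf (thm4TorusAt_printMS_of_leaf)
open Summit.QuantumFields.YangMills.BalabanUVNodes.N16HolderMSTorusOfZd (thm4TorusAt_printMS_of_zd)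

noncomputable section

/-! ## §1 The leaf-form interface slot at a bundle, on N05's family at Hölder exponent `β`, with the multi-scale letters -/

/-- **THE LEAF-FORM INTERFACE SLOT AT A BUNDLE `c : NE3Carriers N` ON `zdGF3 (M_N ℂ) c.L β len`, MULTI-SCALE LETTERS** — dag-n16-c's `N16HolderLeafSlot.LeafSlotHolder c β`
VERBATIM but for (i) the LENGTH LETTER: `∀ μ j, len (j • e μ) = j` (the length normalisation along lattice lines that reads N05's (1.36)₃ supremum at every separation
`1 ≤ j ≤ L^k`; it contains the β-slot's `len (e μ) = 1` at `j = 1`) and (ii) the Hölder threshold `B_h·X + 10·α_{b′}·(B·X) ≤ c.Λ₂'` (the β-slot has `8·`): for SOME length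
function and letters as displayed, `B8.Thm4Body c₁ B₁′` AND `B8.Prop3Body cP 4 c.L C₂ inp B₀β` on `fun i : {i : ZdIdx 4 c.L // i.Ω 0 = univ} ↦ zdGF3 (M_N ℂ) c.L β len i.1`
([Balaban1985RegularSpaces] Thm 4 ∕ Prop 3 as typed by n05-a, all-torus sub-family, Hölder member at its PRINTED exponent «β ≦ β₀ < 1») AND N07's `LeafH3sup`.  A hypothesis
SHAPE — asserted for no bundle here. [cite: Balaban1985RegularSpaces, Thm 4 p.88, Prop. 3 p.87, (1.36) p.82] -/
@[folklore]
def LeafSlotHolderMS {N : ℕ} (c : NE3Carriers N) (β : ℝ) : Prop :=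
  letI : CStarAlgebra (Matrix (Fin N) (Fin N) ℂ) := {}
  ∃ (len : Site 4 → ℝ) (c₁ c₁' B₁' cP C₂ B₀β : ℝ) (inp : B8.B9Inputs) (B Bh b' c' α Mc C335 : ℝ) (𝒬 : ℕ → Set (Set (Site 4) × ℕ)),
    (∀ v : Site 4, 0 < len v → 1 ≤ len v) ∧ (∀ (μ : Fin 4) (j : ℕ), len (j • e μ) = j) ∧ 0 < B₁' ∧ 5 * ((4 : ℕ) : ℝ) * c.L * inp.B₀ ≤ B₁' ∧
    B = 5 * ((4 : ℕ) : ℝ) * c.L * inp.B₀ ∧ Bh = 5 * ((4 : ℕ) : ℝ) * c.L * B₀β ∧ 16 * (B * c₁') ≤ 1 ∧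
    (∀ α₀ α₁ : ℝ, 0 < α₀ → 0 < α₁ → α₀ + α₁ ≤ c₁' →
      α₀ + α₁ ≤ c₁ ∧ C0 4 * (2 * α₀) ≤ 1 / 3 ∧ 4 * α₀ ≤ c2' 4 c.L ∧ 16 * (B₁' * (α₀ + α₁)) ≤ 1 ∧
      Real.exp (4 * (800 * (((4 : ℕ) : ℝ) + 1) ^ 2 * (((4 : ℕ) : ℝ) + 4)) * α₀) * (1 + 8 * (131072 * (((4 : ℕ) : ℝ) + 1) ^ 2) * (B₁' * (α₀ + α₁))) ≤ 2 ∧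
      2 * (B₁' * (α₀ + α₁)) ≤ c3 4 c.L ∧ ((4 : ℕ) : ℝ) * c.L * α₁ ≤ 1 / 8 ∧ α₀ ≤ cP ∧ α₁ ≤ cP ∧ B₁' * (α₀ + α₁) ≤ cP ∧
      2 * (B₁' * (α₀ + α₁)) ^ 2 + 20 * ((4 : ℕ) : ℝ) * α₀ * (B₁' * (α₀ + α₁)) + 2 * C₂ * (B₁' * (α₀ + α₁)) ^ 2 ≤ α₀ + α₁) ∧
    0 ≤ b' ∧ 0 ≤ c' ∧ 2 ^ 15 * ((4 : ℝ) + 1) ^ 2 * ((4 : ℝ) + 4) ^ 2 * (c.L : ℝ) ^ 2 * b' ≤ 1 ∧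
    23040 * (4 : ℝ) ^ 4 * (frameC 4 c.L + 4) ^ 3 * (c' + curConst 4 c.L * b' ^ 2) ≤ 1 ∧
    0 < α ∧ C0 4 * α ≤ 1 / 3 ∧ 2 * α ≤ c2' 4 c.L ∧ 11 * (4 : ℝ) ^ 2 * α ≤ 1 / 6 ∧ α + 11 * (4 : ℝ) ^ 2 * α ≤ c₁' ∧
    (b' + 226 * (8 * ((4 : ℝ) + 1) * ((4 : ℝ) + 4)) ^ 2 * b' ^ 2) < α ∧ 4 * ((4 : ℝ) - 1) * (c' + curConst 4 c.L * b' ^ 2) < α ∧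
    0 ≤ Mc ∧ (Mc + 1) * (b' + 226 * (8 * ((4 : ℝ) + 1) * ((4 : ℝ) + 4)) ^ 2 * b' ^ 2) ≤ 1 / 2 ∧
    (∀ k, ∀ q ∈ 𝒬 k, q.2 ≤ k ∧ ∃ y : Site 4, ∀ z ∈ q.1, (l1 (z - y) : ℝ) ≤ Mc * (c.L : ℝ) ^ q.2) ∧
    2 * (Mc + 1) * (b' + 226 * (8 * ((4 : ℝ) + 1) * ((4 : ℝ) + 4)) ^ 2 * b' ^ 2) + 2 * Mc * (2 * (c' + curConst 4 c.L * b' ^ 2)) +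
      4 * Mc * (1 + 2 * Mc) * (b' + 226 * (8 * ((4 : ℝ) + 1) * ((4 : ℝ) + 4)) ^ 2 * b' ^ 2) ^ 2 < C335 ∧
    c.ε < α ∧ B * (α + 11 * (4 : ℝ) ^ 2 * α) ≤ c.Λ₁ ∧
    B * (α + 11 * (4 : ℝ) ^ 2 * α) + 2 * (b' + 226 * (8 * ((4 : ℝ) + 1) * ((4 : ℝ) + 4)) ^ 2 * b' ^ 2) * c.Λ₁ ≤ c.Λ₁ ∧
    B * (α + 11 * (4 : ℝ) ^ 2 * α) + 16 * (b' + 226 * (8 * ((4 : ℝ) + 1) * ((4 : ℝ) + 4)) ^ 2 * b' ^ 2) * (B * (α + 11 * (4 : ℝ) ^ 2 * α)) ≤ c.Λ₁ ∧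
    Bh * (α + 11 * (4 : ℝ) ^ 2 * α) + 10 * (b' + 226 * (8 * ((4 : ℝ) + 1) * ((4 : ℝ) + 4)) ^ 2 * b' ^ 2) * (B * (α + 11 * (4 : ℝ) ^ 2 * α)) ≤ c.Λ₂' ∧
    B8.Thm4Body c₁ B₁' (fun i : {i : ZdIdx 4 c.L // i.Ω 0 = Set.univ} => (zdGF3 (Matrix (Fin N) (Fin N) ℂ) c.L β len i.1).toGFData) ∧
    B8.Prop3Body cP 4 (c.L : ℝ) C₂ inp B₀β (fun i : {i : ZdIdx 4 c.L // i.Ω 0 = Set.univ} => (zdGF3 (Matrix (Fin N) (Fin N) ℂ) c.L β len i.1).toGFData2) ∧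
    LeafH3sup 4 c.L c.Nper c.ε b' c' c.dom

/-- **THE MS LEAF SLOT IMPLIES dag-n16-c's LEAF β-SLOT** — `LeafSlotHolderMS c β → LeafSlotHolder c β`: the length letter at `j = 1` is `len (e μ) = 1` (`one_smul`), and the
`10·` threshold dominates the `8·` one (`α_{b′} ≥ 0`, `B·X ≥ 0`); every other clause verbatim.  So nothing of the β-kit is orphaned under R-β″:
`LeafSlotHolderMS → LeafSlotHolder → PrintSlotHolder → N16HolderAt` stays available beside the MS road. [folklore] -/
theorem leafSlotHolder_of_leafSlotHolderMS {N : ℕ} (c : NE3Carriers N) {β : ℝ} (h : LeafSlotHolderMS c β) : LeafSlotHolder c β := by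
  letI : CStarAlgebra (Matrix (Fin N) (Fin N) ℂ) := {}
  obtain ⟨len, c₁, c₁', B₁', cP, C₂, B₀β, inp, B, Bh, b', c', α, Mc, C335, 𝒬, hlen, hlenj, hB₁', hBB, hBdef, hBhdef, hBc, hwin,
    hb', hc', hRb, hcF, hα, hA3, hA2, hAs, hAc, hb'α, hc'α, hMc, hMcα, h𝒬, hC335, hεα, hss, hgrad, hℓ, hhol, hT, hP, h3⟩ := h
  have hlen1 : ∀ μ : Fin 4, len (e μ) = 1 := fun μ => by simpa only [one_smul, Nat.cast_one] using hlenj μ 1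
  have hB0 : 0 ≤ B := by rw [hBdef]; have := inp.B₀_pos.le; positivity
  have hX0 : 0 ≤ B * (α + 11 * (4 : ℝ) ^ 2 * α) := mul_nonneg hB0 (by positivity)
  have hab : 0 ≤ b' + 226 * (8 * ((4 : ℝ) + 1) * ((4 : ℝ) + 4)) ^ 2 * b' ^ 2 := by positivity
  have hhol8 : Bh * (α + 11 * (4 : ℝ) ^ 2 * α) + 8 * (b' + 226 * (8 * ((4 : ℝ) + 1) * ((4 : ℝ) + 4)) ^ 2 * b' ^ 2) * (B * (α + 11 * (4 : ℝ) ^ 2 * α))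
      ≤ c.Λ₂' := by nlinarith [mul_nonneg hab hX0]
  exact ⟨len, c₁, c₁', B₁', cP, C₂, B₀β, inp, B, Bh, b', c', α, Mc, C335, 𝒬, hlen, hlen1, hB₁', hBB, hBdef, hBhdef, hBc, hwin,
    hb', hc', hRb, hcF, hα, hA3, hA2, hAs, hAc, hb'α, hc'α, hMc, hMcα, h𝒬, hC335, hεα, hss, hgrad, hℓ, hhol8, hT, hP, h3⟩

/-! ## §2 The leaf-form MS β-slot implies the print-form MS β-slot -/

/-- **`LeafSlotHolderMS c β → PrintSlotHolderMS c β`** (`2 ≤ c.L`, `0 ≤ β`) — dag-n16-c's `printSlotHolder_of_leafSlotHolder` with the (1.36)₃ line multi-scale: N05's leaf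
conjuncts on the univ sub-family of `zdGF3 … c.L β len` + the window + the length letter give Theorem 4 on the `ℤᵈ` carriers at every level `k ≥ 1` in N16's letters without
periodicity, Hölder line along lattice lines (dag-n16-c column 34 `thm4TorusAt_printMS_of_leaf`, `B = 5·4·L·B₀`, `B_h = 5·4·L·B₀β`), and the periodicity principle upgrades it to
the all-torus geometry at period `c.Nper·c.Lᵏ` (column 32 `thm4TorusAt_printMS_of_zd`); the other conjuncts are carried verbatim with `c₁ := c₁′`. [folklore] -/
theorem printSlotHolderMS_of_leafSlotHolderMS {N : ℕ} [NeZero N] (c : NE3Carriers N) (hL : 2 ≤ c.L) {β : ℝ} (hβ : 0 ≤ β) (h : LeafSlotHolderMS c β) :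
    PrintSlotHolderMS c β := by
  letI : CStarAlgebra (Matrix (Fin N) (Fin N) ℂ) := {}
  haveI : Nonempty (Fin N) := ⟨⟨0, Nat.pos_of_ne_zero (NeZero.ne N)⟩⟩
  obtain ⟨len, c₁, c₁', B₁', cP, C₂, B₀β, inp, B, Bh, b', c', α, Mc, C335, 𝒬, hlen, hlenj, hB₁', hBB, hBdef, hBhdef, hBc, hwin,
    hb', hc', hRb, hcF, hα, hA3, hA2, hAs, hAc, hb'α, hc'α, hMc, hMcα, h𝒬, hC335, hεα, hss, hgrad, hℓ, hhol, hT, hP, h3⟩ := h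
  have hL1 : 1 ≤ c.L := le_trans one_le_two hL
  have hB0 : 0 ≤ B := by rw [hBdef]; have := inp.B₀_pos.le; positivity
  -- N05's leaf at exponent `β` ⟹ Theorem 4 on the `ℤᵈ` carriers at every level (period `0`), in N16's letters with `B`, `B_h`, Hölder line multi-scale
  have hzd := thm4TorusAt_printMS_of_leaf (d := 4) (n := Fin N) (by norm_num) hL hβ hlen hlenj hB₁' hBB hwin
    (fun k => Reg335Zd (((c.L : ℝ) ^ k)⁻¹) c.L (𝒬 k) C335) hT hP
  refine ⟨c₁', B, Bh, b', c', α, Mc, C335, 𝒬, hb', hc', hRb, hcF, hα, hA3, hA2, hAs, hAc, hb'α, hc'α, hMc, hMcα, h𝒬, hC335, hεα, hss, hgrad, hℓ,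
    hhol, fun k hk => ?_, h3⟩
  have hη : 0 < ((c.L : ℝ) ^ k)⁻¹ := by
    have : (0 : ℝ) < c.L := by exact_mod_cast lt_of_lt_of_le one_pos hL1
    positivity
  have hη1 : ((c.L : ℝ) ^ k)⁻¹ ≤ 1 := inv_le_one_of_one_le₀ (one_le_pow₀ (by exact_mod_cast hL1))
  have hk' := hzd k hk
  rw [← hBdef, ← hBhdef] at hk'
  exact thm4TorusAt_printMS_of_zd (d := 4) (n := Fin N) hL1 k c.Nper hη hη1 hB0 hBc _ hk'

/-! ## §3 The one-application closers in the leaf currency — MS at `β ∈ [0, 1]`, β through the first bridge, the exponent of record through both -/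

section Closers

variable {N : ℕ} [NeZero N]

/-- **THE ONE-APPLICATION CLOSER IN THE LEAF CURRENCY, MS — `InEndRegimeHMS c → LeafSlotHolderMS c β → N16HolderMSAt c β`** (`0 ≤ β ≤ 1`): a bundle in THE END's MS regime
carrying the leaf-form MS β-slot satisfies the R-β″ analogue of N16's record decl (§2 + module 24's `n16HolderMSAt_of_inEndRegimeHMS_printSlotHolderMS`; `2 ≤ c.L` is the
proviso's first clause). [folklore] -/
theorem n16HolderMSAt_of_inEndRegimeHMS_leafSlotHolderMS {c : NE3Carriers N} (hreg : InEndRegimeHMS c) {β : ℝ} (hβ0 : 0 ≤ β) (hβ1 : β ≤ 1)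
    (hslot : LeafSlotHolderMS c β) : N16HolderMSAt c β :=
  n16HolderMSAt_of_inEndRegimeHMS_printSlotHolderMS hreg hβ0 hβ1 (printSlotHolderMS_of_leafSlotHolderMS c hreg.1 hβ0 hslot)

/-- **… THE β-CURRENCY THROUGH THE FIRST BRIDGE — `InEndRegimeHMS c → LeafSlotHolder c β → N16HolderAt c β`** (`0 ≤ β ≤ 1`; dag-n16-c's (E2) closer after module 24's
`inEndRegimeH_of_inEndRegimeHMS`). [folklore] -/
theorem n16HolderAt_of_inEndRegimeHMS_leafSlotHolder {c : NE3Carriers N} (hreg : InEndRegimeHMS c) {β : ℝ} (hβ0 : 0 ≤ β) (hβ1 : β ≤ 1)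
    (hslot : LeafSlotHolder c β) : N16HolderAt c β :=
  n16HolderAt_of_inEndRegimeH_leafSlotHolder (inEndRegimeH_of_inEndRegimeHMS hreg) hβ0 hβ1 hslot

/-- **… AND AT THE EXPONENT OF RECORD — `InEndRegimeHMS c → LeafSlot c → N16At c`** (n16-e's leaf slot OF RECORD to N16's decl OF RECORD through the first bridge and
dag-n16-c's `n16At_of_inEndRegimeH_leafSlot`). [folklore] -/
theorem n16At_of_inEndRegimeHMS_leafSlot {c : NE3Carriers N} (hreg : InEndRegimeHMS c) (hslot : LeafSlot c) : N16At c :=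
  n16At_of_inEndRegimeH_leafSlot (inEndRegimeH_of_inEndRegimeHMS hreg) hslot

/-- **`S_N16HolderMS β RRec` FOR EVERY RATE-RECORD PREDICATE WHOSE BUNDLES ARE IN THE MS REGIME AND CARRY THE MS LEAF β-SLOT** (`0 ≤ β ≤ 1`; `RRec`-generic): the N05
in-edge consumed in N05's OWN typed currency at its residual exponent, N07's as `LeafH3sup`.  Neither is asserted here. [folklore] -/
theorem s_N16HolderMS_of_inEndRegimeHMS_leafSlotHolderMS (RRec : RateRecordPred N) {β : ℝ} (hβ0 : 0 ≤ β) (hβ1 : β ≤ 1)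
    (h : ∀ (F : T4Family) (D : Datum F N) (g₀ : ℕ → ℝ) (os : List (ULoop F)) (R : RateCarriers N), RRec F D g₀ os R →
      InEndRegimeHMS R.ne3 ∧ LeafSlotHolderMS R.ne3 β) :
    S_N16HolderMS β RRec :=
  fun F D g₀ os R hR => n16HolderMSAt_of_inEndRegimeHMS_leafSlotHolderMS (h F D g₀ os R hR).1 hβ0 hβ1 (h F D g₀ os R hR).2

/-- **`S_N16Holder β RRec` FROM THE MS REGIME AND THE LEAF β-SLOT** (`0 ≤ β ≤ 1`; `RRec`-generic). [folklore] -/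
theorem s_N16Holder_of_inEndRegimeHMS_leafSlotHolder (RRec : RateRecordPred N) {β : ℝ} (hβ0 : 0 ≤ β) (hβ1 : β ≤ 1)
    (h : ∀ (F : T4Family) (D : Datum F N) (g₀ : ℕ → ℝ) (os : List (ULoop F)) (R : RateCarriers N), RRec F D g₀ os R →
      InEndRegimeHMS R.ne3 ∧ LeafSlotHolder R.ne3 β) :
    S_N16Holder β RRec :=
  fun F D g₀ os R hR => n16HolderAt_of_inEndRegimeHMS_leafSlotHolder (h F D g₀ os R hR).1 hβ0 hβ1 (h F D g₀ os R hR).2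

/-- **`S_N16 RRec` (THE STUB OF RECORD) FROM THE MS REGIME AND THE LEAF SLOT OF RECORD** (`RRec`-generic). [folklore] -/
theorem s_N16_of_inEndRegimeHMS_leafSlot (RRec : RateRecordPred N)
    (h : ∀ (F : T4Family) (D : Datum F N) (g₀ : ℕ → ℝ) (os : List (ULoop F)) (R : RateCarriers N), RRec F D g₀ os R →
      InEndRegimeHMS R.ne3 ∧ LeafSlot R.ne3) :
    S_N16 RRec :=
  fun F D g₀ os R hR => n16At_of_inEndRegimeHMS_leafSlot (h F D g₀ os R hR).1 (h F D g₀ os R hR).2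

end Closers

/-! ## §4 From node N05's leaf of record SHAPE on `zdGF3 … c.L β len` to the MS leaf β-slot -/

/-- **FROM N05's LEAF OF RECORD AT ITS RESIDUAL EXPONENT TO THE MS LEAF β-SLOT** (`2 ≤ c.L`; any `β`) — dag-n16-c's `leafSlotHolder_of_b8LeafRS` with the two MS letter deltas:
node N05's leaf shape `B8LeafRS 4 c.L C₂ B₁′ B₀′ B₁ B₂ c₁ inp B₀β loc fam lan cub toAxial` at `fam := fun i : {i : ZdIdx 4 c.L // i.Ω 0 = univ} ↦ zdGF3 (M_N ℂ) c.L β len i.1` (only `t4`,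
`p3` read), `len ≥ 1` on its support, the LENGTH LETTER `len (j•e_μ) = j`, `0 < B₁′`, `5·4·c.L·B₀ ≤ B₁′`, YIELDS a window threshold `c₁′ > 0` with `16·(5·4·c.L·B₀·c₁′) ≤ 1`
(`N16.OfLeaf.exists_window_print`) such that for all leaf letters, averaging letter, (3.35) schedule on the slot's displayed lines at `c₁′` with `B := 5·4·c.L·B₀`,
`B_h := 5·4·c.L·B₀β` (Hölder threshold `10·`), N07's `LeafH3sup` gives `LeafSlotHolderMS c β`. [folklore] -/
theorem leafSlotHolderMS_of_b8LeafRS {N : ℕ} [NeZero N] (c : NE3Carriers N) (hL : 2 ≤ c.L) {β : ℝ} {I₁ I₃ I₄ : Type} {C₂ B₁' B₀' B₁ B₂ c₁ : ℝ} {inp : B8.B9Inputs}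
    {B₀β : ℝ} {loc : I₁ → B8.LocalData} {lan : I₃ → B8.LandauData} {cub : I₄ → B8.CubeData} {len : Site 4 → ℝ}
    {toAxial : letI : CStarAlgebra (Matrix (Fin N) (Fin N) ℂ) := {}
      ∀ i : {i : ZdIdx 4 c.L // i.Ω 0 = Set.univ},
        (zdGF3 (Matrix (Fin N) (Fin N) ℂ) c.L β len i.1).Cfg → (zdGF3 (Matrix (Fin N) (Fin N) ℂ) c.L β len i.1).Pert →
          (zdGF3 (Matrix (Fin N) (Fin N) ℂ) c.L β len i.1).Pert}
    (hlen : ∀ v : Site 4, 0 < len v → 1 ≤ len v) (hlenj : ∀ (μ : Fin 4) (j : ℕ), len (j • e μ) = j) (hB₁' : 0 < B₁')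
    (hBB : 5 * ((4 : ℕ) : ℝ) * c.L * inp.B₀ ≤ B₁')
    (leaf : letI : CStarAlgebra (Matrix (Fin N) (Fin N) ℂ) := {}
      B8LeafRS 4 (c.L : ℝ) C₂ B₁' B₀' B₁ B₂ c₁ inp B₀β loc
        (fun i : {i : ZdIdx 4 c.L // i.Ω 0 = Set.univ} => zdGF3 (Matrix (Fin N) (Fin N) ℂ) c.L β len i.1) lan cub toAxial) :
    ∃ c₁' : ℝ, 0 < c₁' ∧ 16 * (5 * ((4 : ℕ) : ℝ) * c.L * inp.B₀ * c₁') ≤ 1 ∧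
      ∀ ⦃b' c' : ℝ⦄, 0 ≤ b' → 0 ≤ c' →
      2 ^ 15 * ((4 : ℝ) + 1) ^ 2 * ((4 : ℝ) + 4) ^ 2 * (c.L : ℝ) ^ 2 * b' ≤ 1 →
      23040 * (4 : ℝ) ^ 4 * (frameC 4 c.L + 4) ^ 3 * (c' + curConst 4 c.L * b' ^ 2) ≤ 1 →
      ∀ ⦃α : ℝ⦄, 0 < α → C0 4 * α ≤ 1 / 3 → 2 * α ≤ c2' 4 c.L → 11 * (4 : ℝ) ^ 2 * α ≤ 1 / 6 → α + 11 * (4 : ℝ) ^ 2 * α ≤ c₁' →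
      b' + 226 * (8 * ((4 : ℝ) + 1) * ((4 : ℝ) + 4)) ^ 2 * b' ^ 2 < α → 4 * ((4 : ℝ) - 1) * (c' + curConst 4 c.L * b' ^ 2) < α →
      ∀ ⦃Mc : ℝ⦄, 0 ≤ Mc → (Mc + 1) * (b' + 226 * (8 * ((4 : ℝ) + 1) * ((4 : ℝ) + 4)) ^ 2 * b' ^ 2) ≤ 1 / 2 →
      ∀ (𝒬 : ℕ → Set (Set (Site 4) × ℕ)), (∀ k, ∀ q ∈ 𝒬 k, q.2 ≤ k ∧ ∃ y : Site 4, ∀ z ∈ q.1, (l1 (z - y) : ℝ) ≤ Mc * (c.L : ℝ) ^ q.2) →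
      ∀ ⦃C335 : ℝ⦄, 2 * (Mc + 1) * (b' + 226 * (8 * ((4 : ℝ) + 1) * ((4 : ℝ) + 4)) ^ 2 * b' ^ 2) + 2 * Mc * (2 * (c' + curConst 4 c.L * b' ^ 2)) +
        4 * Mc * (1 + 2 * Mc) * (b' + 226 * (8 * ((4 : ℝ) + 1) * ((4 : ℝ) + 4)) ^ 2 * b' ^ 2) ^ 2 < C335 →
      c.ε < α → 5 * ((4 : ℕ) : ℝ) * c.L * inp.B₀ * (α + 11 * (4 : ℝ) ^ 2 * α) ≤ c.Λ₁ →
      5 * ((4 : ℕ) : ℝ) * c.L * inp.B₀ * (α + 11 * (4 : ℝ) ^ 2 * α) +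
          2 * (b' + 226 * (8 * ((4 : ℝ) + 1) * ((4 : ℝ) + 4)) ^ 2 * b' ^ 2) * c.Λ₁ ≤ c.Λ₁ →
      5 * ((4 : ℕ) : ℝ) * c.L * inp.B₀ * (α + 11 * (4 : ℝ) ^ 2 * α) + 16 * (b' + 226 * (8 * ((4 : ℝ) + 1) * ((4 : ℝ) + 4)) ^ 2 * b' ^ 2) *
          (5 * ((4 : ℕ) : ℝ) * c.L * inp.B₀ * (α + 11 * (4 : ℝ) ^ 2 * α)) ≤ c.Λ₁ →
      5 * ((4 : ℕ) : ℝ) * c.L * B₀β * (α + 11 * (4 : ℝ) ^ 2 * α) + 10 * (b' + 226 * (8 * ((4 : ℝ) + 1) * ((4 : ℝ) + 4)) ^ 2 * b' ^ 2) *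
          (5 * ((4 : ℕ) : ℝ) * c.L * inp.B₀ * (α + 11 * (4 : ℝ) ^ 2 * α)) ≤ c.Λ₂' →
      LeafH3sup 4 c.L c.Nper c.ε b' c' c.dom → LeafSlotHolderMS c β := by
  letI : CStarAlgebra (Matrix (Fin N) (Fin N) ℂ) := {}
  -- the two thresholds of the leaf's `t4` ∕ `p3`, and the window threshold below them
  obtain ⟨c₁t, hc₁t, hT⟩ := leaf.t4
  obtain ⟨cP, hcP, hP⟩ := leaf.p3
  obtain ⟨c₁', hc₁', hwin⟩ := exists_window_print (d := 4) (L := c.L) (by norm_num) hL C₂ hc₁t hcP hB₁'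
  have h16 : 16 * (5 * ((4 : ℕ) : ℝ) * c.L * inp.B₀ * c₁') ≤ 1 := by
    obtain ⟨-, -, -, h, -⟩ := hwin (c₁' / 2) (c₁' / 2) (by linarith) (by linarith) (by linarith)
    have h' : 16 * (B₁' * c₁') ≤ 1 := by rwa [add_halves] at h
    nlinarith [mul_le_mul_of_nonneg_right hBB hc₁'.le]
  refine ⟨c₁', hc₁', h16, fun b' c' hb' hc' hRb hcF α hα hA3 hA2 hAs hAc hb'α hc'α Mc hMc hMcα 𝒬 h𝒬 C335 hC335 hεα hss hgrad hℓ hhol h3 => ?_⟩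
  exact ⟨len, c₁t, c₁', B₁', cP, C₂, B₀β, inp, 5 * ((4 : ℕ) : ℝ) * c.L * inp.B₀, 5 * ((4 : ℕ) : ℝ) * c.L * B₀β, b', c', α, Mc, C335, 𝒬, hlen, hlenj,
    hB₁', hBB, rfl, rfl, by linarith [h16], hwin, hb', hc', hRb, hcF, hα, hA3, hA2, hAs, hAc, hb'α, hc'α, hMc, hMcα, h𝒬, hC335, hεα, hss, hgrad, hℓ,
    hhol, hT, hP, h3⟩

end

end Summit.QuantumFields.YangMills.BalabanUVNodes.N16HolderMSLeafSlot
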